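import Mathlib

/-!
# Tower graft line — two-sided words: THE LOEWNER CERTIFICATE FOR EVERY REAL EXPONENT `0 < p ≤ 1` (kernel)

Crux `stmt-ValiantsHypothesis-19561` (`WeakLifting`), line (B) `tower_graft`, two-sided word instrument; seat val-sym-lift-p3 g21,
`--supports 19561`, NO stub claimed.  Parts C/F of the two-sided three-letter series (`…TwoSidedThreeLettersKernels`,
`…TwoSidedClusteredUppers`, seat g20) reduce their rank laws to an ABSTRACT positive semidefinite certificate: the LOEWNER MATRIX
`L = [(yᵢᵖ − yₖᵖ)/(yᵢ − yₖ)]`, diagonal `p·yᵢᵖ⁻¹`, of the power `y ↦ yᵖ` at distinct positive nodes, which was typed only for the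
algebraic exponents `p = 1, 1/2, 1/4` (all ones, Cauchy, Cauchy ⊙ Cauchy).  This file supplies it for EVERY real `0 < p ≤ 1`
(`exists_loewner_certificate`): from Mathlib's integral representation of the power
(`Real.rpow_eq_const_mul_integral`: `yᵖ = c⁻¹ ∫₀^∞ t^{p-1} y/(t+y) dt`, `0 < p < 1`) the divided difference is
`c⁻¹ ∫₀^∞ tᵖ /((t+yᵢ)(t+yₖ)) dt` — a positive mixture of rank-one kernels, hence positive semidefinite — and its diagonal value
`p·yᵖ⁻¹` is pinned WITHOUT differentiating under the integral, by squeezing the (antitone in the second node) kernel integral between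
left and right difference quotients of `yᵖ` (`Real.hasDerivAt_rpow_const`).  Corollary in the currency of part C and of its
two-gap generalisation (`exists_certificate_two_gaps`): for natural gaps `1 ≤ e ≤ f` and distinct positive scales `sᵢ` a positive
semidefinite `N` with `N_{ii}·(f·sᵢ^{e+f}) = e` and `N_{ik}·(sᵢ^e sₖ^e (sᵢ^f − sₖ^f)) = sᵢ^e − sₖ^e` — the certificate of the reduced
pencil `A + s^e J + s^{e+f} B` whenever the LOWER gap is at most the UPPER gap.  HONEST FRAMING: classical analysis (Loewner 1934 /
Heinz 1951: `yᵖ` is operator monotone for `0 ≤ p ≤ 1`), typed as a tool for the three-letter law on every support (sequel file);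
nothing on S4…S5, `TowerB`, `WeakLifting` in its window, Conjecture B, 18050 or `VP ≠ VNP`.  Def-free; Mathlib only.

[folklore] Loewner matrices of operator monotone powers via the integral representation of `yᵖ`.
-/

set_option linter.dupNamespace false
set_option autoImplicit false

namespace Summit.ValiantsHypothesis.ValiantsHypothesis.Theorems.KPlusLogSqLaw.TowerGraft

namespace TwoSidedThree

namespace Loewner

open MeasureTheory Set Filter Real Matrix
open scoped Topology BigOperators

/-! ## §1 The kernel `t ↦ tᵖ/((t+a)(t+b))` on `(0, ∞)` -/

/-- the Loewner kernel integrand is continuous on `(0,∞)`. [folklore] -/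
theorem continuousOn_kernel (p a b : ℝ) (ha : 0 < a) (hb : 0 < b) :
    ContinuousOn (fun t : ℝ => t ^ p / ((t + a) * (t + b))) (Ioi 0) := by
  have h₀ : ContinuousOn (fun t : ℝ => t ^ p) (Ioi 0) :=
    ContinuousOn.rpow_const continuousOn_id fun t ht => Or.inl (ne_of_gt ht)
  refine ContinuousOn.div h₀ (by fun_prop) ?_
  intro t ht
  have : 0 < t := ht
  positivity

/-- pointwise bound: `tᵖ/((t+a)(t+b)) ≤ a⁻¹ · rpowIntegrand₀₁ p t a` on `(0,∞)`. [folklore] -/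
theorem kernel_le (p a b : ℝ) (hp : p ∈ Ioo 0 1) (ha : 0 < a) (hb : 0 < b) {t : ℝ} (ht : 0 < t) :
    t ^ p / ((t + a) * (t + b)) ≤ a⁻¹ * rpowIntegrand₀₁ p t a := by
  rw [rpowIntegrand₀₁_eq_pow_div hp ht.le ha.le]
  have hta : 0 < t + a := by linarith
  have htb : 0 < t + b := by linarith
  have e1 : t ^ p = t ^ (p - 1) * t := by
    rw [Real.rpow_sub_one (ne_of_gt ht)]; field_simp
  rw [e1]
  rw [div_le_iff₀ (mul_pos hta htb)]
  have e2 : a⁻¹ * (t ^ (p - 1) * a / (t + a)) * ((t + a) * (t + b)) = t ^ (p - 1) * (t + b) := by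
    field_simp
  rw [e2]
  have h1 : 0 ≤ t ^ (p - 1) := Real.rpow_nonneg ht.le _
  nlinarith [mul_nonneg h1 hb.le]

/-- the kernel is nonnegative on `(0,∞)`. [folklore] -/
theorem kernel_nonneg (p a b : ℝ) (ha : 0 < a) (hb : 0 < b) {t : ℝ} (ht : 0 < t) :
    0 ≤ t ^ p / ((t + a) * (t + b)) := by
  have h1 : 0 ≤ t ^ p := Real.rpow_nonneg ht.le _
  positivity

/-- the kernel is integrable on `(0,∞)` (dominated by the `rpow` integrand). [folklore] -/
theorem integrableOn_kernel (p a b : ℝ) (hp : p ∈ Ioo 0 1) (ha : 0 < a) (hb : 0 < b) :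
    IntegrableOn (fun t : ℝ => t ^ p / ((t + a) * (t + b))) (Ioi 0) := by
  have hg : IntegrableOn (fun t : ℝ => a⁻¹ * rpowIntegrand₀₁ p t a) (Ioi 0) :=
    (integrableOn_rpowIntegrand₀₁_Ioi hp ha.le).const_mul a⁻¹
  refine Integrable.mono' hg ((continuousOn_kernel p a b ha hb).aestronglyMeasurable measurableSet_Ioi) ?_
  refine ae_restrict_of_forall_mem measurableSet_Ioi fun t ht => ?_
  rw [Real.norm_of_nonneg (kernel_nonneg p a b ha hb ht)]
  exact kernel_le p a b hp ha hb ht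

/-- the kernel is antitone in its second node. [folklore] -/
theorem kernel_antitone (p a : ℝ) (ha : 0 < a) {b b' : ℝ} (hb : 0 < b) (hbb' : b ≤ b') {t : ℝ} (ht : 0 < t) :
    t ^ p / ((t + a) * (t + b')) ≤ t ^ p / ((t + a) * (t + b)) := by
  have h1 : 0 ≤ t ^ p := Real.rpow_nonneg ht.le _
  have hta : 0 < t + a := by linarith
  have htb : 0 < t + b := by linarith
  exact div_le_div_of_nonneg_left h1 (mul_pos hta htb) (mul_le_mul_of_nonneg_left (by linarith) hta.le)

/-! ## §2 The divided difference of `yᵖ` is the kernel integral -/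

/-- difference of two `rpow` integrands = `(a − b)`·kernel, on `(0,∞)`. [folklore] -/
theorem rpowIntegrand₀₁_sub (p a b : ℝ) {t : ℝ} (ht : 0 < t) (ha : 0 < a) (hb : 0 < b) :
    rpowIntegrand₀₁ p t a - rpowIntegrand₀₁ p t b = (a - b) * (t ^ p / ((t + a) * (t + b))) := by
  unfold rpowIntegrand₀₁
  have hta : t + a ≠ 0 := by linarith
  have htb : t + b ≠ 0 := by linarith
  have htne : t ≠ 0 := ne_of_gt ht
  field_simp
  ring

/-- **the divided-difference identity**: `(∫₀^∞ tᵖ/((t+a)(t+b)) dt)·(a − b) = c·(aᵖ − bᵖ)` with `c = ∫₀^∞ rpowIntegrand₀₁ p t 1 dt > 0`.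
[folklore] -/
theorem integral_kernel_mul_sub (p a b : ℝ) (hp : p ∈ Ioo 0 1) (ha : 0 < a) (hb : 0 < b) :
    (∫ t in Ioi 0, t ^ p / ((t + a) * (t + b))) * (a - b)
      = (∫ t in Ioi 0, rpowIntegrand₀₁ p t 1) * (a ^ p - b ^ p) := by
  set c := ∫ t in Ioi 0, rpowIntegrand₀₁ p t 1 with hc
  have hcpos : 0 < c := integral_rpowIntegrand₀₁_one_pos hp
  have hA := rpow_eq_const_mul_integral hp ha.le
  have hB := rpow_eq_const_mul_integral hp hb.le
  rw [← hc] at hA hB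
  have hsub : (∫ t in Ioi 0, rpowIntegrand₀₁ p t a) - (∫ t in Ioi 0, rpowIntegrand₀₁ p t b)
      = ∫ t in Ioi 0, (rpowIntegrand₀₁ p t a - rpowIntegrand₀₁ p t b) :=
    (integral_sub (integrableOn_rpowIntegrand₀₁_Ioi hp ha.le) (integrableOn_rpowIntegrand₀₁_Ioi hp hb.le)).symm
  have hcongr : (∫ t in Ioi 0, (rpowIntegrand₀₁ p t a - rpowIntegrand₀₁ p t b))
      = ∫ t in Ioi 0, (a - b) * (t ^ p / ((t + a) * (t + b))) :=
    setIntegral_congr_fun measurableSet_Ioi fun t ht => rpowIntegrand₀₁_sub p a b ht ha hb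
  rw [integral_const_mul] at hcongr
  calc (∫ t in Ioi 0, t ^ p / ((t + a) * (t + b))) * (a - b)
      = (a - b) * ∫ t in Ioi 0, t ^ p / ((t + a) * (t + b)) := mul_comm _ _
    _ = (∫ t in Ioi 0, rpowIntegrand₀₁ p t a) - (∫ t in Ioi 0, rpowIntegrand₀₁ p t b) := by rw [hsub, hcongr]
    _ = c * (c⁻¹ * ∫ t in Ioi 0, rpowIntegrand₀₁ p t a) - c * (c⁻¹ * ∫ t in Ioi 0, rpowIntegrand₀₁ p t b) := by
        rw [← mul_assoc, ← mul_assoc, mul_inv_cancel₀ (ne_of_gt hcpos), one_mul, one_mul]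
    _ = c * (a ^ p - b ^ p) := by rw [← hA, ← hB, mul_sub]

/-! ## §3 The diagonal value `p·aᵖ⁻¹` by a squeeze (no differentiation under the integral) -/

/-- **diagonal of the Loewner kernel**: `∫₀^∞ tᵖ/(t+a)² dt = c · p · aᵖ⁻¹`. [folklore] -/
theorem integral_kernel_diag (p a : ℝ) (hp : p ∈ Ioo 0 1) (ha : 0 < a) :
    (∫ t in Ioi 0, t ^ p / ((t + a) * (t + a)))
      = (∫ t in Ioi 0, rpowIntegrand₀₁ p t 1) * (p * a ^ (p - 1)) := by
  set c := ∫ t in Ioi 0, rpowIntegrand₀₁ p t 1 with hc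
  have hcpos : 0 < c := integral_rpowIntegrand₀₁_one_pos hp
  set g : ℝ → ℝ := fun x => ∫ t in Ioi 0, t ^ p / ((t + a) * (t + x)) with hg
  -- `g` is antitone on `(0,∞)`
  have hanti : ∀ x x' : ℝ, 0 < x → x ≤ x' → g x' ≤ g x := by
    intro x x' hx hxx'
    have hx' : 0 < x' := lt_of_lt_of_le hx hxx'
    exact setIntegral_mono_on (integrableOn_kernel p a x' hp ha hx') (integrableOn_kernel p a x hp ha hx)
      measurableSet_Ioi fun t ht => kernel_antitone p a ha hx hxx' ht
  -- off the diagonal `g` is `c ·` the difference quotient of `y ↦ yᵖ` at `a`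
  have hslope : ∀ x : ℝ, 0 < x → x ≠ a → g x = c * slope (fun y : ℝ => y ^ p) a x := by
    intro x hx hxa
    have h1 := integral_kernel_mul_sub p a x hp ha hx
    rw [slope_def_field]
    have hne : a - x ≠ 0 := sub_ne_zero.mpr (Ne.symm hxa)
    have hne' : x - a ≠ 0 := sub_ne_zero.mpr hxa
    have h2 : g x = c * (a ^ p - x ^ p) / (a - x) := by
      rw [eq_div_iff hne]; exact h1
    rw [h2]
    have e : (a ^ p - x ^ p) / (a - x) = (x ^ p - a ^ p) / (x - a) := by
      rw [← neg_sub, ← neg_sub (x) a, neg_div_neg_eq]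
    rw [mul_div_assoc, e]
  -- the difference quotients converge to the derivative `p aᵖ⁻¹`
  have hderiv : HasDerivAt (fun y : ℝ => y ^ p) (p * a ^ (p - 1)) a :=
    Real.hasDerivAt_rpow_const (Or.inl (ne_of_gt ha))
  have htend : Tendsto (slope (fun y : ℝ => y ^ p) a) (𝓝[≠] a) (𝓝 (p * a ^ (p - 1))) :=
    hasDerivAt_iff_tendsto_slope.mp hderiv
  have htend' : Tendsto (fun x => c * slope (fun y : ℝ => y ^ p) a x) (𝓝[≠] a) (𝓝 (c * (p * a ^ (p - 1)))) :=
    htend.const_mul c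
  have hL : Tendsto (fun x => c * slope (fun y : ℝ => y ^ p) a x) (𝓝[<] a) (𝓝 (c * (p * a ^ (p - 1)))) :=
    htend'.mono_left (nhdsWithin_mono a fun x hx => ne_of_lt hx)
  have hR : Tendsto (fun x => c * slope (fun y : ℝ => y ^ p) a x) (𝓝[>] a) (𝓝 (c * (p * a ^ (p - 1)))) :=
    htend'.mono_left (nhdsWithin_mono a fun x hx => ne_of_gt hx)
  -- eventually (from the left) `g a ≤ c · slope`, (from the right) `c · slope ≤ g a`
  have hevL : ∀ᶠ x in 𝓝[<] a, g a ≤ c * slope (fun y : ℝ => y ^ p) a x := by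
    have hmem : Ioo (a / 2) a ∈ 𝓝[<] a := Ioo_mem_nhdsLT (by linarith)
    filter_upwards [hmem] with x hx
    have hx0 : 0 < x := by linarith [hx.1]
    rw [← hslope x hx0 (ne_of_lt hx.2)]
    exact hanti x a hx0 hx.2.le
  have hevR : ∀ᶠ x in 𝓝[>] a, c * slope (fun y : ℝ => y ^ p) a x ≤ g a := by
    have hmem : Ioi a ∈ 𝓝[>] a := self_mem_nhdsWithin
    filter_upwards [hmem] with x hx
    have hx0 : 0 < x := lt_trans ha hx
    rw [← hslope x hx0 (ne_of_gt hx)]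
    exact hanti a x ha (le_of_lt hx)
  have h1 : g a ≤ c * (p * a ^ (p - 1)) := ge_of_tendsto hL hevL
  have h2 : c * (p * a ^ (p - 1)) ≤ g a := le_of_tendsto hR hevR
  show g a = c * (p * a ^ (p - 1))
  exact le_antisymm h1 h2

/-! ## §4 The certificate -/

section Certificate

variable {I : Type} [Fintype I]

/-- the quadratic form of the kernel matrix is `tᵖ·(∑ᵢ xᵢ/(t+yᵢ))²` pointwise. [folklore] -/
theorem sum_sum_kernel_eq_sq (p : ℝ) (y : I → ℝ) (x : I → ℝ) {t : ℝ} (ht : 0 < t) (hy : ∀ i, 0 < y i) :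
    (∑ i, ∑ k, x i * (t ^ p / ((t + y i) * (t + y k))) * x k) = t ^ p * (∑ i, x i / (t + y i)) ^ 2 := by
  have hden : ∀ i, t + y i ≠ 0 := fun i => by have := hy i; linarith
  rw [sq, Finset.sum_mul, Finset.mul_sum]
  refine Finset.sum_congr rfl fun i _ => ?_
  rw [Finset.mul_sum, Finset.mul_sum]
  refine Finset.sum_congr rfl fun k _ => ?_
  have hi := hden i; have hk := hden k
  field_simp

/-- **THE LOEWNER CERTIFICATE (every real exponent `0 < p ≤ 1`).**  At positive nodes `yᵢ` there is a positive semidefinite real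
matrix `L` with `L_{ik} = p·yₖᵖ⁻¹` whenever `yᵢ = yₖ` (in particular on the diagonal; nodes may repeat) and
`L_{ik}·(yᵢ − yₖ) = yᵢᵖ − yₖᵖ` whenever `yᵢ ≠ yₖ` — the Loewner matrix of the operator-monotone
power `y ↦ yᵖ` (for `0 < p < 1`: `c⁻¹ ∫₀^∞ tᵖ/((t+yᵢ)(t+yₖ)) dt`, a positive mixture of rank-one kernels; for `p = 1`: all ones).
[folklore] -/
theorem exists_loewner_certificate {p : ℝ} (hp : p ∈ Ioc 0 1) (y : I → ℝ) (hy : ∀ i, 0 < y i) :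
    ∃ L : Matrix I I ℝ, L.PosSemidef ∧ (∀ i k, y i = y k → L i k = p * y k ^ (p - 1)) ∧
      ∀ i k, y i ≠ y k → L i k * (y i - y k) = y i ^ p - y k ^ p := by
  classical
  rcases eq_or_lt_of_le hp.2 with hp1 | hp1
  · -- `p = 1`: the all-ones matrix
    subst hp1
    refine ⟨Matrix.vecMulVec (fun _ : I => (1 : ℝ)) (fun _ : I => (1 : ℝ)), ?_, ?_, ?_⟩
    · have h := Matrix.posSemidef_vecMulVec_self_star (R := ℝ) (fun _ : I => (1 : ℝ))
      rwa [star_trivial] at h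
    · intro i k _; simp [Matrix.vecMulVec_apply]
    · intro i k _; simp [Matrix.vecMulVec_apply]
  -- `0 < p < 1`: the integral certificate
  have hp' : p ∈ Ioo 0 1 := ⟨hp.1, hp1⟩
  set c := ∫ t in Ioi 0, rpowIntegrand₀₁ p t 1 with hc
  have hcpos : 0 < c := integral_rpowIntegrand₀₁_one_pos hp'
  set L : Matrix I I ℝ := Matrix.of fun i k => c⁻¹ * ∫ t in Ioi 0, t ^ p / ((t + y i) * (t + y k)) with hL
  refine ⟨L, ?_, ?_, ?_⟩
  · -- positive semidefinite: the quadratic form is `c⁻¹ ∫ tᵖ (∑ xᵢ/(t+yᵢ))² ≥ 0`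
    refine Matrix.PosSemidef.of_dotProduct_mulVec_nonneg ?_ fun x => ?_
    · rw [Matrix.IsHermitian, Matrix.conjTranspose_eq_transpose_of_trivial]
      ext i k
      simp only [Matrix.transpose_apply, hL, Matrix.of_apply]
      congr 1
      refine setIntegral_congr_fun measurableSet_Ioi fun t _ => ?_
      rw [mul_comm (t + y k)]
    · rw [star_trivial]
      have hform : x ⬝ᵥ (L *ᵥ x) = c⁻¹ * ∑ i, ∑ k, x i * (∫ t in Ioi 0, t ^ p / ((t + y i) * (t + y k))) * x k := by
        simp only [dotProduct, Matrix.mulVec, hL, Matrix.of_apply, Finset.mul_sum]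
        refine Finset.sum_congr rfl fun i _ => Finset.sum_congr rfl fun k _ => by ring
      have hint : ∀ i k, IntegrableOn (fun t : ℝ => t ^ p / ((t + y i) * (t + y k))) (Ioi 0) :=
        fun i k => integrableOn_kernel p (y i) (y k) hp' (hy i) (hy k)
      have hswap : (∑ i, ∑ k, x i * (∫ t in Ioi 0, t ^ p / ((t + y i) * (t + y k))) * x k)
          = ∫ t in Ioi 0, ∑ i, ∑ k, x i * (t ^ p / ((t + y i) * (t + y k))) * x k := by
        rw [integral_finsetSum _ fun i _ => ?_]
        · refine Finset.sum_congr rfl fun i _ => ?_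
          rw [integral_finsetSum _ fun k _ => ?_]
          · refine Finset.sum_congr rfl fun k _ => ?_
            rw [integral_mul_const, integral_const_mul]
          · exact ((hint i k).const_mul (x i)).mul_const (x k)
        · exact integrable_finsetSum _ fun k _ => ((hint i k).const_mul (x i)).mul_const (x k)
      rw [hform, hswap]
      refine mul_nonneg (inv_nonneg.mpr hcpos.le) (setIntegral_nonneg measurableSet_Ioi fun t ht => ?_)
      rw [sum_sum_kernel_eq_sq p y x ht hy]
      exact mul_nonneg (Real.rpow_nonneg (le_of_lt ht) _) (sq_nonneg _)
  · -- diagonal (and equal nodes)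
    intro i k hik
    simp only [hL, Matrix.of_apply]
    rw [hik, integral_kernel_diag p (y k) hp' (hy k), ← hc, ← mul_assoc, inv_mul_cancel₀ (ne_of_gt hcpos), one_mul]
  · -- off-diagonal
    intro i k hik
    simp only [hL, Matrix.of_apply]
    rw [mul_assoc, integral_kernel_mul_sub p (y i) (y k) hp' (hy i) (hy k), ← hc, ← mul_assoc,
      inv_mul_cancel₀ (ne_of_gt hcpos), one_mul]


/-! ## §5 Certificates in the currencies of the two-sided series -/

/-- `(s^b)^{a/b} = s^a` for a positive real base and natural exponents. [folklore] -/
theorem pow_rpow_div_natCast {s : ℝ} (hs : 0 < s) (a b : ℕ) (hb : b ≠ 0) :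
    (s ^ b) ^ ((a : ℝ) / b) = s ^ a := by
  rw [← Real.rpow_natCast s b, ← Real.rpow_mul hs.le, mul_div_cancel₀ _ (Nat.cast_ne_zero.mpr hb),
    Real.rpow_natCast]

/-- `(s^b)^{a/b − 1} = s^a / s^b` for a positive real base and natural exponents. [folklore] -/
theorem pow_rpow_div_natCast_sub_one {s : ℝ} (hs : 0 < s) (a b : ℕ) (hb : b ≠ 0) :
    (s ^ b) ^ ((a : ℝ) / b - 1) = s ^ a / s ^ b := by
  rw [Real.rpow_sub (pow_pos hs b), Real.rpow_one, pow_rpow_div_natCast hs a b hb]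

/-- **certificate for TWO GAPS `e ≤ f`, FAMILY form** (reduced pencil `A + s^e J + s^{e+f} B`, LOWER gap at most the UPPER gap;
scales may REPEAT): a positive semidefinite `N` with `N_{ik}·(f·sₖ^{e+f}) = e` whenever `sᵢ = sₖ` and
`N_{ik}·(sᵢ^e sₖ^e (sᵢ^f − sₖ^f)) = sᵢ^e − sₖ^e` whenever `sᵢ ≠ sₖ` (`N = D⁻¹ L D⁻¹`, `D = diag(s^e)`, `L` the Loewner matrix of
`y ↦ y^{e/f}` at `yᵢ = sᵢ^f`). [folklore] -/
theorem exists_certificate_two_gaps_family {e f : ℕ} (he : 1 ≤ e) (hef : e ≤ f) (s : I → ℝ) (hs : ∀ i, 0 < s i) :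
    ∃ N : Matrix I I ℝ, N.PosSemidef ∧ (∀ i k, s i = s k → N i k * ((f : ℝ) * s k ^ (e + f)) = e) ∧
      ∀ i k, s i ≠ s k → N i k * (s i ^ e * s k ^ e * (s i ^ f - s k ^ f)) = s i ^ e - s k ^ e := by
  classical
  have hf : f ≠ 0 := by omega
  have hq : ((e : ℝ) / f) ∈ Ioc (0 : ℝ) 1 := by
    refine ⟨div_pos (Nat.cast_pos.mpr (by omega)) (Nat.cast_pos.mpr (Nat.pos_of_ne_zero hf)), ?_⟩
    rw [div_le_one (Nat.cast_pos.mpr (Nat.pos_of_ne_zero hf))]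
    exact_mod_cast hef
  obtain ⟨L, hL, hLdiag, hLoff⟩ := exists_loewner_certificate hq (fun i => s i ^ f) (fun i => pow_pos (hs i) f)
  set N : Matrix I I ℝ := Matrix.of fun i k => (s i ^ e)⁻¹ * L i k * (s k ^ e)⁻¹ with hN
  refine ⟨N, ?_, ?_, ?_⟩
  · have hNeq : N = (Matrix.diagonal fun i => (s i ^ e)⁻¹) * L * (Matrix.diagonal fun i => (s i ^ e)⁻¹) := by
      ext i k
      simp only [hN, Matrix.of_apply, Matrix.mul_diagonal, Matrix.diagonal_mul]
    rw [hNeq]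
    have h := hL.conjTranspose_mul_mul_same (Matrix.diagonal fun i => (s i ^ e)⁻¹)
    rwa [Matrix.conjTranspose_eq_transpose_of_trivial, Matrix.diagonal_transpose] at h
  · intro i k hik
    simp only [hN, Matrix.of_apply]
    rw [hLdiag i k (by simp only [hik]), pow_rpow_div_natCast_sub_one (hs k) e f hf, hik]
    have h1 : s k ^ e ≠ 0 := pow_ne_zero _ (ne_of_gt (hs k))
    have h2 : s k ^ f ≠ 0 := pow_ne_zero _ (ne_of_gt (hs k))
    rw [pow_add]
    field_simp
  · intro i k hik
    simp only [hN, Matrix.of_apply]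
    have hne : s i ^ f ≠ s k ^ f := fun h =>
      hik ((pow_left_inj₀ (hs i).le (hs k).le hf).mp h)
    have h0 := hLoff i k hne
    rw [pow_rpow_div_natCast (hs i) e f hf, pow_rpow_div_natCast (hs k) e f hf] at h0
    have h1 : s i ^ e ≠ 0 := pow_ne_zero _ (ne_of_gt (hs i))
    have h2 : s k ^ e ≠ 0 := pow_ne_zero _ (ne_of_gt (hs k))
    calc (s i ^ e)⁻¹ * L i k * (s k ^ e)⁻¹ * (s i ^ e * s k ^ e * (s i ^ f - s k ^ f))
        = ((s i ^ e)⁻¹ * s i ^ e) * ((s k ^ e)⁻¹ * s k ^ e) * (L i k * (s i ^ f - s k ^ f)) := by ring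
      _ = s i ^ e - s k ^ e := by rw [inv_mul_cancel₀ h1, inv_mul_cancel₀ h2, one_mul, one_mul, h0]

/-- **certificate for TWO GAPS `e ≤ f`** at DISTINCT positive scales: `N_{ii}·(f·sᵢ^{e+f}) = e` and
`N_{ik}·(sᵢ^e sₖ^e (sᵢ^f − sₖ^f)) = sᵢ^e − sₖ^e` (`i ≠ k`). [folklore] -/
theorem exists_certificate_two_gaps {e f : ℕ} (he : 1 ≤ e) (hef : e ≤ f) (s : I → ℝ) (hs : ∀ i, 0 < s i)
    (hinj : Function.Injective s) :
    ∃ N : Matrix I I ℝ, N.PosSemidef ∧ (∀ i, N i i * ((f : ℝ) * s i ^ (e + f)) = e) ∧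
      ∀ i k, i ≠ k → N i k * (s i ^ e * s k ^ e * (s i ^ f - s k ^ f)) = s i ^ e - s k ^ e := by
  obtain ⟨N, hN, hdiag, hoff⟩ := exists_certificate_two_gaps_family (I := I) he hef s hs
  exact ⟨N, hN, fun i => hdiag i i rfl, fun i k hik => hoff i k fun h => hik (hinj h)⟩

/-- **certificate in part C's currency, EVERY gap `n ≥ 1`, FAMILY form** (reduced pencil `A + s J + s^{n+1} B`; scales may repeat):
`N_{ik}·(n sₖ^{n+1}) = 1` whenever `sᵢ = sₖ`, `N_{ik}·(sᵢsₖ(sᵢⁿ − sₖⁿ)) = sᵢ − sₖ` whenever `sᵢ ≠ sₖ` — the Loewner matrix of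
`y ↦ y^{1/n}`; the binders of part E′'s `card_posType_le_rank_of_certificate_family`. [folklore] -/
theorem exists_certificate_gap_family (n : ℕ) (hn : 1 ≤ n) (s : I → ℝ) (hs : ∀ i, 0 < s i) :
    ∃ N : Matrix I I ℝ, N.PosSemidef ∧ (∀ i k, s i = s k → N i k * (n * s k ^ (n + 1)) = 1) ∧
      ∀ i k, s i ≠ s k → N i k * (s i * s k * (s i ^ n - s k ^ n)) = s i - s k := by
  obtain ⟨N, hN, hdiag, hoff⟩ := exists_certificate_two_gaps_family (I := I) (e := 1) (f := n) le_rfl hn s hs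
  refine ⟨N, hN, fun i k hik => ?_, fun i k hik => ?_⟩
  · have h := hdiag i k hik
    rw [Nat.add_comm] at h
    exact_mod_cast h
  · have h := hoff i k hik
    simpa only [pow_one] using h

/-- **certificate in part C's currency, EVERY gap `n ≥ 1`** (distinct scales; supports `(d, d+e, d+(n+1)e)`):
`N_{ii}·(n sᵢ^{n+1}) = 1`, `N_{ik}·(sᵢsₖ(sᵢⁿ − sₖⁿ)) = sᵢ − sₖ` — VERBATIM the certificate binders of part C's
`card_posType_le_rank_of_certificate`; `n = 3` (the 3-tower `(0,1,4)`) and every non-dyadic gap were untyped before. [folklore] -/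
theorem exists_certificate_gap (n : ℕ) (hn : 1 ≤ n) (s : I → ℝ) (hs : ∀ i, 0 < s i) (hinj : Function.Injective s) :
    ∃ N : Matrix I I ℝ, N.PosSemidef ∧ (∀ i, N i i * (n * s i ^ (n + 1)) = 1) ∧
      ∀ i k, i ≠ k → N i k * (s i * s k * (s i ^ n - s k ^ n)) = s i - s k := by
  obtain ⟨N, hN, hdiag, hoff⟩ := exists_certificate_gap_family (I := I) n hn s hs
  exact ⟨N, hN, fun i => hdiag i i rfl, fun i k hik => hoff i k fun h => hik (hinj h)⟩

/-- **certificate in part F's currency, EVERY CLUSTERED UPPER LETTER `e < d ≤ 2e`** (word `P₀ + τ^e J + Σ τ^{dₗ} Pₗ`, upper gap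
`d − e` at most the lower gap `e`; distinct positive scales): `e·N_{ii} = (d − e)·τᵢ^d`,
`N_{ik}·(τᵢ^e − τₖ^e) = τᵢ^d τₖ^e − τᵢ^e τₖ^d` — VERBATIM the per-letter certificate binders of part F's
`card_negType_le_rank_clustered`; `N = D L D` with `D = diag(τ^e)` and `L` the Loewner matrix of `y ↦ y^{(d−e)/e}` at `yᵢ = τᵢ^e`.
[folklore] -/
theorem exists_certificate_clustered {e d : ℕ} (he : 1 ≤ e) (hed : e < d) (hd : d ≤ 2 * e) (τ : I → ℝ)
    (hτ : ∀ i, 0 < τ i) (hinj : Function.Injective τ) :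
    ∃ N : Matrix I I ℝ, N.PosSemidef ∧ (∀ i, (e : ℝ) * N i i = ((d - e : ℕ) : ℝ) * τ i ^ d) ∧
      ∀ i k, i ≠ k → N i k * (τ i ^ e - τ k ^ e) = τ i ^ d * τ k ^ e - τ i ^ e * τ k ^ d := by
  classical
  have he0 : e ≠ 0 := by omega
  have hq : (((d - e : ℕ) : ℝ) / e) ∈ Ioc (0 : ℝ) 1 := by
    refine ⟨div_pos (Nat.cast_pos.mpr (by omega)) (Nat.cast_pos.mpr (by omega)), ?_⟩
    rw [div_le_one (Nat.cast_pos.mpr (by omega))]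
    exact_mod_cast (by omega : d - e ≤ e)
  obtain ⟨L, hL, hLdiag, hLoff⟩ := exists_loewner_certificate hq (fun i => τ i ^ e) (fun i => pow_pos (hτ i) e)
  set N : Matrix I I ℝ := Matrix.of fun i k => τ i ^ e * L i k * τ k ^ e with hN
  refine ⟨N, ?_, ?_, ?_⟩
  · have hNeq : N = (Matrix.diagonal fun i => τ i ^ e) * L * (Matrix.diagonal fun i => τ i ^ e) := by
      ext i k
      simp only [hN, Matrix.of_apply, Matrix.mul_diagonal, Matrix.diagonal_mul]
    rw [hNeq]
    have h := hL.conjTranspose_mul_mul_same (Matrix.diagonal fun i => τ i ^ e)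
    rwa [Matrix.conjTranspose_eq_transpose_of_trivial, Matrix.diagonal_transpose] at h
  · intro i
    simp only [hN, Matrix.of_apply]
    rw [hLdiag i i rfl, pow_rpow_div_natCast_sub_one (hτ i) (d - e) e he0]
    have h1 : τ i ^ e ≠ 0 := pow_ne_zero _ (ne_of_gt (hτ i))
    have hsplit : τ i ^ d = τ i ^ (d - e) * τ i ^ e := by rw [← pow_add, Nat.sub_add_cancel hed.le]
    rw [hsplit]
    field_simp
  · intro i k hik
    simp only [hN, Matrix.of_apply]
    have hne : τ i ^ e ≠ τ k ^ e := fun h =>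
      hik (hinj ((pow_left_inj₀ (hτ i).le (hτ k).le he0).mp h))
    have h0 := hLoff i k hne
    rw [pow_rpow_div_natCast (hτ i) (d - e) e he0, pow_rpow_div_natCast (hτ k) (d - e) e he0] at h0
    have hsi : τ i ^ d = τ i ^ (d - e) * τ i ^ e := by rw [← pow_add, Nat.sub_add_cancel hed.le]
    have hsk : τ k ^ d = τ k ^ (d - e) * τ k ^ e := by rw [← pow_add, Nat.sub_add_cancel hed.le]
    calc τ i ^ e * L i k * τ k ^ e * (τ i ^ e - τ k ^ e)
        = τ i ^ e * τ k ^ e * (L i k * (τ i ^ e - τ k ^ e)) := by ring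
      _ = τ i ^ e * τ k ^ e * (τ i ^ (d - e) - τ k ^ (d - e)) := by rw [h0]
      _ = τ i ^ d * τ k ^ e - τ i ^ e * τ k ^ d := by rw [hsi, hsk]; ring

end Certificate

end Loewner

end TwoSidedThree

end Summit.ValiantsHypothesis.ValiantsHypothesis.Theorems.KPlusLogSqLaw.TowerGraft
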